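import Literature.AlgebraicGeometry.HodgeTheory.MiddleDimensionReductionOfHodgeClassLift
import Literature.AlgebraicGeometry.Resolution.ProjectiveResolutionProofs
import HarnessLib

/-!
# Divisor induction: rational Hodge classes supported on a divisor of an `(n+1)`-fold are algebraic,
# granted the Hodge conjecture in one codimension less on `n`-folds (from Deligne's Cor. 8.2.8 and
# the lifting of Hodge classes along Gysin morphisms)

Family `hodge`, layer `Literature/AlgebraicGeometry/HodgeTheory`. Consumer: the support item
`DivisorInduction` (stmt-HodgeConjecture-1082), shared verbatim by the routes
`Summits/HodgeConjecture/HodgeConjecture/Theses/NodalSupport` and `…/Theses/LinearSystemTorelli`: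

> if HC holds in codimension `p − 1` for smooth projective `n`-folds, then on a smooth projective
> `(n+1)`-fold every rational `(p,p)` class supported on a divisor is algebraic. Proof: enlarge the
> support to a divisor `D`; `ker(H^{2p}(X) → H^{2p}(X∖D))` = Gysin image of `H^{2p−2}(D̃)(−1)` for a
> resolution `D̃ → D` (Deligne, Hodge III Cor. 8.2.8); the Gysin map is a morphism of polarisable
> Hodge structures, so by semisimplicity a Hodge class in the image lifts to a Hodge class on `D̃`
> (componentwise, `D̃ = ⊔ D̃_j` smooth projective of dim `n`); HC(`D̃_j`, `p−1`) and 'push-forward of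
> algebraic is algebraic' conclude.

This is the mechanism of R. Thomas, *Nodes and the Hodge conjecture*, J. Algebraic Geom. 14 (2005),
§2 (the induction behind Thm. 1), of U. Jannsen, *Mixed Motives and Algebraic K-Theory*, LNM 1400
(1990), §7, Thm. 7.9, and of C. Voisin, *Hodge and generalized Hodge conjectures, coniveau and
algebraic cycles*, J. Open Math. Probl. 1 (2025), Cor. 2.12 with Thm. 4.4 / Cor. 4.5 (i) and the
proofs of Prop. 3.8 / Prop. 5.15 — exactly the argument already run in the tree for the sibling
statement `supportedHodgeClassDescent_of` (`HodgeTheory/SupportedHodgeClassDescent`, which assumes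
the Hodge conjecture in ALL codimensions on ALL varieties of dimension `< dim X`). The present item
grants LESS: the Hodge conjecture in the single codimension `p − 1` and only on `n`-folds
(`dim X = n + 1`). The printed remedy is "enlarge the support to a divisor"; this file uses the
equivalent padding device of Brosnan–Fang–Nie–Pearlstein, Lemma 48 (as in
`HodgeTheory/MiddleDimensionReductionOfHodgeClassLift`): a resolution `Ỹⱼ` of dimension `mⱼ ≤ n` of
a component of the support is replaced by `Ỹⱼ × ℙ^{n − mⱼ} ⟶ Ỹⱼ ⟶ X`, a morphism from an `n`-fold with
the same image (the first projection is onto), so that Deligne's theorem is applied to a family of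
`n`-folds and the lifted Hodge classes have type `(p − 1, p − 1)` on `n`-folds, where the hypothesis
applies. No divisor containing the support is needed.

PROVED here, introducing no named fact (D-0026), from the tree's two undischarged named facts that
carry the printed proof —

* `hA : Deligne1974_ker_restrictCompl_eq_iSup_range_complexGysin` (`HodgeTheory/GysinKernel`;
  Deligne, *Hodge III*, Cor. 8.2.8 = Voisin 2025 Thm. 4.4: `ker (Hᵇ(X(ℂ)) → Hᵇ((X ∖ ⋃ⱼ gⱼ(Yⱼ))(ℂ)))
  = Σⱼ im (gⱼ)_*`),
* `hB : Voisin2025_hodgeClass_lift_complexGysin` (`HodgeTheory/GysinHodgeClassLift`; Voisin 2025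
  Cor. 2.12, the semisimplicity of polarisable Hodge structures: a rational `(q,q)`-class in
  `Σⱼ im (gⱼ)_*` is a combination of `(gⱼ)_* bⱼ` with `bⱼ` rational of type `(dⱼ, dⱼ)`),

— and the tree's THEOREMS for the remaining printed ingredients: projective Hironaka
(`Resolution.Hironaka1964_projective_holds`), Poincaré duality for the complex orientations
(`OrientationFamily.hasPoincareDuality`), the support property of Gysin maps
(`gysinMap_restrictCompl_eq_zero_of_field ℂ`, Fulton App. B §B.2 Ex. 5), products with projective
spaces (`Motives.IsSmoothProjective.tensor_holds`, `Motives.isSmoothProjective_projectiveSpace_holds`,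
`Motives.sliceAt_fst`):

* `surjective_fst_left_base` — `pr₁ : Y × T ⟶ Y` is onto (on scheme points) once `T(ℂ) ≠ ∅`;
* `exists_equidim_family_iUnion_range_eq` — a Zariski-closed `Z ⊆ X^{n+1}` of codimension `≥ 1`
  is `⋃ⱼ gⱼ(Yⱼ)` for finitely many morphisms from smooth projective `Yⱼ` of dimension EXACTLY `n`;
* `divisorInduction_of_deligne_of_hodgeClassLift` — the item's statement verbatim, from `hA`, `hB`.

Not here: the discharge of `hA` (Deligne's mixed Hodge theory: the open child
`Deligne1974_ker_pullback_eq_ker_pullback_resolution`, `HodgeTheory/GysinKernelSplit`) or of `hB`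
(Hodge–Riemann polarizability, real Hodge models and de Rham:
`Voisin2025_hodgeClass_lift_complexGysin_holds_of`, `HodgeTheory/HodgeRiemannPolarizability`) —
both XL and shared with the rest of the `hodge` family; with them the item closes by the last
theorem of this file.

## References

* [DeligneHodgeIII1974] P. Deligne, Théorie de Hodge III, Publ. Math. IHÉS 44 (1974), Cor. 8.2.8.
* [Voisin2025] C. Voisin, Hodge and generalized Hodge conjectures, coniveau and algebraic cycles,
  J. Open Math. Probl. 1 (2025) 16–51, Cor. 2.12 (p. 24), Thm. 4.4 and Cor. 4.5 (p. 38), proofs of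
  Prop. 3.8 (p. 28) and Prop. 5.15 (p. 45).
* [Thomas2005Nodes] R. Thomas, Nodes and the Hodge conjecture, J. Algebraic Geom. 14 (2005), §2.
* [Jannsen1990MixedMotives] U. Jannsen, Mixed Motives and Algebraic K-Theory, LNM 1400, §7 Thm. 7.9.
* [BrosnanFangNiePearlstein2009] P. Brosnan, H. Fang, Z. Nie, G. Pearlstein, Singularities of
  admissible normal functions, Invent. Math. 177 (2009), §6 Lemma 48 (the `× ℙʳ` padding).
* [Kollar2007] J. Kollár, Lectures on Resolution of Singularities, Thm. 3.27.
* [FultonYoungTableaux1997] W. Fulton, Young Tableaux, App. B §B.1 (5), §B.2 Exercise 5.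
-/

noncomputable section

open CategoryTheory AlgebraicGeometry MonoidalCategory CartesianMonoidalCategory
open Literature.AlgebraicTopology.SingularHomology

namespace Literature.AlgebraicGeometry.HodgeTheory

section HodgeTheory

/-! ### The first projection of a product is onto -/

/-- The first projection `Y ×_ℂ T ⟶ Y` is surjective on the points of the underlying schemes as
soon as `T` has a `ℂ`-point `t`: the slice `i_t : Y ≅ Y × {t} ⟶ Y × T` is a section of it
(`Motives.sliceAt_fst`). [folklore] -/
theorem surjective_fst_left_base {Y T : Motives.SchemeOver ℂ} (t : Motives.AlgPoints T ℂ) :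
    Function.Surjective (fst Y T).left.base := by
  intro y
  refine ⟨(Motives.sliceAt Y t).left.base y, ?_⟩
  have h := congrArg (fun f : Y ⟶ Y ↦ f.left.base y) (Motives.sliceAt_fst Y t)
  simp only [Over.comp_left, Scheme.Hom.comp_base, Over.id_left, Scheme.Hom.id_base,
    TopCat.comp_app, TopCat.id_app] at h
  exact h

/-! ### Padding the components of a proper closed subset to dimension `n` -/

/-- **A closed subset of codimension `≥ 1` of an `(n+1)`-fold is covered by `n`-folds.** For `X`
smooth projective of dimension `n + 1` over `ℂ` and `Z ⊆ X` Zariski-closed all of whose points have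
codimension `≥ 1`, `Z` is the joint image `⋃ⱼ gⱼ(Yⱼ)` of finitely many morphisms `gⱼ : Yⱼ ⟶ X` from
smooth projective varieties `Yⱼ` of dimension EXACTLY `n`: resolve the irreducible components of `Z`
(`exists_family_iUnion_range_eq`, with Hironaka in the tree's proved form
`Resolution.Hironaka1964_projective_holds`; the resolutions `Ỹⱼ` have dimensions `mⱼ ≤ n`) and
replace `Ỹⱼ` by the `n`-fold `Ỹⱼ × ℙ^{n − mⱼ}` (`Motives.IsSmoothProjective.tensor_holds`) mapped
through the first projection, which is onto (`surjective_fst_left_base`; `ℙʳ(ℂ) ≠ ∅`), so that the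
images are unchanged — the padding "set `X = Y × ℙ^{2k − dim Y}`" of Brosnan–Fang–Nie–Pearlstein.
[cite: BrosnanFangNiePearlstein2009, §6 Lemma 48 (proof)] [cite: Kollar2007, Thm. 3.27] -/
theorem exists_equidim_family_iUnion_range_eq {n : ℕ} {X : Motives.SchemeOver ℂ}
    (hX : Motives.IsSmoothProjective (n + 1) X) {Z : Set X.left} (hZ : IsClosed Z)
    (hZ1 : ∀ z ∈ Z, (1 : ℕ∞) ≤ Order.coheight z) :
    ∃ (ι : Type) (_ : Finite ι) (Y : ι → Motives.SchemeOver ℂ)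
      (_ : ∀ j, Motives.IsSmoothProjective n (Y j)) (g : ∀ j, Y j ⟶ X),
      ⋃ j, Set.range (g j).left.base = Z := by
  obtain ⟨ι, hι, m, Y, hY, g, hm, hZg⟩ :=
    exists_family_iUnion_range_eq Resolution.Hironaka1964_projective_holds hX hZ hZ1
  -- pad each `Y j` (dimension `m j ≤ n`) by a projective space of dimension `n - m j`
  let P : ι → Motives.SchemeOver ℂ := fun j ↦ Motives.projectiveSpace (n - m j) ℂ
  have hP : ∀ j, Motives.IsSmoothProjective (n - m j) (P j) := fun j ↦
    Motives.isSmoothProjective_projectiveSpace_holds ℂ (n - m j)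
  have hYP : ∀ j, Motives.IsSmoothProjective n (Y j ⊗ P j) := fun j ↦ by
    have h := Motives.IsSmoothProjective.tensor_holds (hY j) (hP j)
    have e : m j + (n - m j) = n := by have := hm j; omega
    rwa [e] at h
  refine ⟨ι, hι, fun j ↦ Y j ⊗ P j, hYP, fun j ↦ fst (Y j) (P j) ≫ g j, ?_⟩
  rw [← hZg]
  refine Set.iUnion_congr fun j ↦ ?_
  haveI := connectedSpace_complexPoints (hP j)
  obtain ⟨t⟩ : Nonempty (Motives.ComplexPoints (P j)) := inferInstance
  rw [Over.comp_left, Scheme.Hom.comp_base, TopCat.coe_comp, Set.range_comp,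
    (surjective_fst_left_base t).range_eq, Set.image_univ]

/-! ### Divisor induction -/

/-- **Divisor induction** (the support item `DivisorInduction`, stmt-HodgeConjecture-1082, of the
routes `NodalSupport` / `LinearSystemTorelli`, VERBATIM), from the two named facts of the tree that
carry its printed proof — Deligne, *Hodge III*, Cor. 8.2.8 (`hA`: the classes killed off
`Z = ⋃ⱼ gⱼ(Yⱼ)` are the sums of Gysin images from the `Yⱼ`) and the lifting of Hodge classes along
Gysin morphisms (`hB`: Voisin 2025 Cor. 2.12, semisimplicity of polarisable Hodge structures).
Statement: let `1 ≤ p`; if on every smooth projective `n`-fold every rational `(p-1, p-1)`-class is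
algebraic, then on every smooth projective `(n+1)`-fold `X` every rational `(p, p)`-class `c`
supported on a divisor (`c ∈ N¹ H²ᵖ(X(ℂ); ℂ) = supportedClasses X (2p) 1`) is algebraic
(`c ∈ algebraicClasses X p = Nᵖ H²ᵖ`). Proof as printed: `c` dies off a closed `Z` of codimension
`≥ 1` (`exists_isClosed_of_mem_supportedClasses`); `Z = ⋃ⱼ gⱼ(Yⱼ)` with `Yⱼ` smooth projective of
dimension exactly `n` (`exists_equidim_family_iUnion_range_eq`); by `hA` and `hB` (chained in the
tree as `Voisin2025_hodgeClass_lift_complexGysin.mem_iSup_map_of_restrictCompl_eq_zero`)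
`c = Σⱼ (gⱼ)_* bⱼ` with `bⱼ` in the `ℂ`-span of the rational `(d, d)`-classes of `Yⱼ`,
`2d + 2(n+1) = 2p + 2n`, i.e. `d = p − 1`; these are algebraic by the hypothesis on the `n`-folds
`Yⱼ`, and Gysin images of algebraic classes are algebraic (`complexGysin_mem_algebraicClasses`, from
the tree's proved support property `gysinMap_restrictCompl_eq_zero_of_field ℂ`). The Gysin morphisms
are those of the orientation family of the complex orientations, whose Poincaré duality is the
tree's theorem `OrientationFamily.hasPoincareDuality`. CONDITIONAL exactly on `hA`, `hB`.
[cite: DeligneHodgeIII1974, Cor. 8.2.8] [cite: Voisin2025, Cor. 2.12 (p. 24), Thm. 4.4 and Cor. 4.5 (p. 38)]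
[cite: Thomas2005Nodes, §2] [cite: Jannsen1990MixedMotives, §7 Thm. 7.9] -/
theorem divisorInduction_of_deligne_of_hodgeClassLift
    (hA : Deligne1974_ker_restrictCompl_eq_iSup_range_complexGysin)
    (hB : Voisin2025_hodgeClass_lift_complexGysin) :
    ∀ (n p : ℕ), 1 ≤ p →
      (∀ ⦃Y : Motives.SchemeOver ℂ⦄, Motives.IsSmoothProjective n Y →
        ∀ c : complexBetti Y (2 * (p - 1)), IsRationalClass c →
          IsOfHodgeType n Y (2 * (p - 1)) (p - 1) (p - 1) c → c ∈ algebraicClasses Y (p - 1)) →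
      ∀ ⦃X : Motives.SchemeOver ℂ⦄, Motives.IsSmoothProjective (n + 1) X →
        ∀ c : complexBetti X (2 * p), IsRationalClass c → IsOfHodgeType (n + 1) X (2 * p) p p c →
          c ∈ supportedClasses X (2 * p) 1 → c ∈ algebraicClasses X p := by
  intro n p _hp hHC X hX c hc hc' hsupp
  classical
  -- an orientation family (the complex orientations) and its Poincaré duality (a theorem)
  let μ : OrientationFamily :=
    fun _ _ h ↦ Classical.choice (Motives.ComplexPoints.isOrientableOver ℂ h)
  have hμ : μ.HasPoincareDuality := μ.hasPoincareDuality
  -- `c` dies off one closed `Z` of codimension `≥ 1`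
  obtain ⟨Z, hZ, hZ1, hcZ⟩ := exists_isClosed_of_mem_supportedClasses hsupp
  -- `Z = ⋃ⱼ gⱼ(Yⱼ)` with `Yⱼ` smooth projective of dimension exactly `n`
  obtain ⟨ι, hι, Y, hY, g, hZg⟩ := exists_equidim_family_iUnion_range_eq hX hZ hZ1
  haveI := hι
  -- Deligne's Cor. 8.2.8 and Cor. 2.12: `c ∈ Σⱼ (gⱼ)_* span {rational (d, d)-classes on Yⱼ}`
  have hmem := Voisin2025_hodgeClass_lift_complexGysin.mem_iSup_map_of_restrictCompl_eq_zero hA hB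
    μ hμ hX (m := fun _ ↦ n) hY g hZg hc hc' hcZ
  refine SetLike.le_def.mp (iSup_le fun j ↦ iSup_le fun d ↦ iSup_le fun hd ↦ ?_) hmem
  rw [Submodule.map_le_iff_le_comap, Submodule.span_le]
  rintro b ⟨hb, hb'⟩
  rw [SetLike.mem_coe, Submodule.mem_comap]
  -- `d = p - 1`: the hypothesis on the `n`-fold `Y j`, then push forward
  obtain rfl : d = p - 1 := by omega
  have halg : b ∈ algebraicClasses (Y j) (p - 1) := hHC (hY j) b hb hb'
  exact complexGysin_mem_algebraicClasses (gysinMap_restrictCompl_eq_zero_of_field ℂ) μ hμ (hY j) hX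
    (g j) (by omega) hd halg

end HodgeTheory

end Literature.AlgebraicGeometry.HodgeTheory

end
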